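import Summits.AtomisticToContinuum.HydrodynamicLimit.Theorems.RelayRaceLocalityLightConeInLawSVCLine
import Literature.MathematicalPhysics.KineticTheory.HardSphereEulerRatio

/-!
# Lipschitz bound for the insertion ratios of the canonical hard-sphere gas on `𝕋³` at low density

Helper file (`--supports stmt-AtomisticToContinuum-12500`) of the line `susceptibility-variance-continuity`
of the crux `LightConeInLaw`, for the stub `stub_countLCLT` (statics of the Poissonised count law
`p_{N,μ}(n) ∝ μⁿ Z_{N,n}/n!`). It supplies the one input of cluster-expansion type that the tree's canonical
statics (`Literature/MathematicalPhysics/KineticTheory/HardSphereEulerRatio`) does not state: an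
**approximate log-concavity of the canonical partition functions in the particle number**, in the
form of a Lipschitz bound, uniform in the number of particles, for the inverse insertion probabilities
`q_N(m) = Ξ_N(m)/Ξ_N(m+1)`:

  `|q_N(m+1) - q_N(m)| ≤ 64 e² · p_{ε_N} = 64 e² λ / (N+1)`   for all `m + 1 ≤ N`,

once the reduced density is small (`SmallDensity P σ` and `λ = ovDensity P σ ≤ 1/(64 e²)`). In words: the mean
free-volume fraction seen by an extra sphere changes by `O(ε³)` when one sphere is added, i.e.
`Ξ(m+2) Ξ(m) = Ξ(m+1)² (1 + O(ε³))`; for the Poissonised count law this is a two-sided bound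
`(1 ± O(λ))/ν` on the discrete curvature of `log p_{N,μ}`, whence two-sided linear count variance and
the local central-limit lower bound (assembled downstream).

Proof (an elementary contraction, in the vocabulary of `HardSphereEulerRatio`): by the ratio identity
`1/q_N(m) = Σ_{j ≤ m} C(m,j) W¹(j+1) r_N(m,j)` (`inv_qN_eq_sum`) and Pascal's rule,
`1/q_N(m+1) - 1/q_N(m) = Σ_{i ≤ m} C(m,i) W¹(i+2) r_N(m+1,i+1) + Σ_{i<m} C(m,i+1) W¹(i+2) (r_N(m+1,i+1) - r_N(m,i+1))`
(`inv_qN_succ_sub_inv_qN`). The first sum is `≤ 8e² p_ε` by the tree bound `|W¹(k)| ≤ t(k) p_ε^{k-1}`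
(`abs_Wd_le`, `treeNumber_succ_succ_mul_pow_div_factorial_le`); the difference of the ratio products
telescopes, `|r_N(m+1,j) - r_N(m,j)| ≤ j 2ʲ D` if all earlier consecutive differences of `q_N` are `≤ D`
(`abs_rN_succ_sub_rN_le`), so the second sum is `≤ 8e² λ D` (`abs_coefN_le`). Hence
`|q_N(m+1) - q_N(m)| ≤ 32e² p_ε + 32 e² λ D`, and `D = 64 e² p_ε` propagates by induction on `m` as soon as
`32 e² λ ≤ 1/2`. References: E. Pulvirenti, D. Tsagkarogiannis, Comm. Math. Phys. 316 (2012) §3–5 (cluster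
expansion in the canonical ensemble); D. Ruelle, *Statistical Mechanics* (1969) Ch. 4.
-/

namespace Summit.AtomisticToContinuum.HydrodynamicLimit.Theorems.LightConeInLawSVC.CountLCLT

open scoped BigOperators
open Finset
open Literature.MathematicalPhysics.KineticTheory Literature.Probability.LatticeModels
  Literature.MathematicalPhysics.StatisticalMechanics

noncomputable section

variable {P : DensityProfile} {σ : ℝ}

/-- `Σ_{i<n} (i+1) rⁱ ≤ 4` for `0 ≤ r ≤ 1/2` (the series sums to `(1-r)⁻²`). [folklore] -/
theorem sum_succ_mul_pow_le_four {r : ℝ} (hr0 : 0 ≤ r) (hr : r ≤ 1 / 2) (n : ℕ) :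
    ∑ i ∈ range n, ((i : ℝ) + 1) * r ^ i ≤ 4 := by
  have hr1 : r < 1 := by linarith
  have hnorm : ‖r‖ < 1 := by rw [Real.norm_eq_abs, abs_of_nonneg hr0]; exact hr1
  have h1 := hasSum_coe_mul_geometric_of_norm_lt_one (𝕜 := ℝ) hnorm
  have h2 := hasSum_geometric_of_lt_one hr0 hr1
  have hle := sum_le_hasSum (range n) (fun i _ => by positivity) (h1.add h2)
  have h1r : 1 / 2 ≤ 1 - r := by linarith
  have ha : r / (1 - r) ^ 2 ≤ 2 := by
    rw [div_le_iff₀ (by positivity)]; nlinarith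
  have hb : (1 - r)⁻¹ ≤ 2 := by
    rw [inv_le_comm₀ (by linarith) (by norm_num)]; linarith
  calc ∑ i ∈ range n, ((i : ℝ) + 1) * r ^ i = ∑ i ∈ range n, ((i : ℝ) * r ^ i + r ^ i) :=
        sum_congr rfl fun i _ => by ring
    _ ≤ r / (1 - r) ^ 2 + (1 - r)⁻¹ := hle
    _ ≤ 4 := by linarith

section Bounds

variable (h : SmallDensity P σ) (hsmall : ovDensity P σ ≤ 1 / (64 * Real.exp 1 ^ 2))
include h hsmall

omit h in
/-- The smallness condition `λ ≤ 1/(64e²)` gives `θ = 2eλ ≤ 1/2` (for `σ ≥ 0`). [folklore] -/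
theorem geomRatio_le_half_of_ovDensity_le (hσ : 0 ≤ σ) : geomRatio P σ ≤ 1 / 2 := by
  have he : (2 : ℝ) ≤ Real.exp 1 := by linarith [Real.add_one_le_exp (1 : ℝ)]
  have hl0 := ovDensity_nonneg (P := P) hσ
  unfold geomRatio
  have h1 : 2 * Real.exp 1 * ovDensity P σ ≤ 2 * Real.exp 1 * (1 / (64 * Real.exp 1 ^ 2)) :=
    mul_le_mul_of_nonneg_left hsmall (by positivity)
  refine h1.trans ?_
  rw [mul_one_div, div_le_div_iff₀ (by positivity) (by norm_num)]
  nlinarith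

omit hsmall in
/-- **Differences of the ratio products.** If `|q_N(k+1) - q_N(k)| ≤ D` for all `k < m`, then
`|r_N(m+1, j) - r_N(m, j)| ≤ j 2ʲ D` for `j ≤ m` (`m ≤ N`): the two products of `j` ratios differ in
one factor at a time. [folklore] -/
theorem abs_rN_succ_sub_rN_le {N m : ℕ} (hm : m ≤ N) {D : ℝ} (hD : 0 ≤ D)
    (hq : ∀ k < m, |qN P σ N (k + 1) - qN P σ N k| ≤ D) :
    ∀ {j : ℕ}, j ≤ m → |rN P σ N (m + 1) j - rN P σ N m j| ≤ j * 2 ^ j * D := by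
  have hl1 := h.ovDensity_lt_one
  intro j
  induction j with
  | zero =>
      intro _
      rw [rN_zero h.σ_pos.le h.σ_lt_half hl1 (by omega), rN_zero h.σ_pos.le h.σ_lt_half hl1 (by omega), sub_self, abs_zero]
      simp
  | succ j ih =>
      intro hj
      have ih' := ih (by omega)
      rw [rN_succ h.σ_pos.le h.σ_lt_half hl1 (m := m + 1) (by omega) (by omega),
        rN_succ h.σ_pos.le h.σ_lt_half hl1 (m := m) (by omega) hj]
      have hk : m + 1 - 1 - j = (m - 1 - j) + 1 := by omega
      rw [hk]
      have hkm : m - 1 - j < m := by omega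
      have hqk := hq (m - 1 - j) hkm
      have hq0 : 0 ≤ qN P σ N (m - 1 - j + 1) := (qN_pos h.σ_pos.le h.σ_lt_half hl1 (by omega)).le
      have hq2 : qN P σ N (m - 1 - j + 1) ≤ 2 := h.qN_le_two (by omega)
      have hr0 : 0 ≤ rN P σ N m j := zero_le_one.trans (one_le_rN h.σ_pos.le h.σ_lt_half hl1 (by omega) (by omega))
      have hr2 : rN P σ N m j ≤ 2 ^ j := h.rN_le_two_pow (by omega) (by omega)
      have hsplit : rN P σ N (m + 1) j * qN P σ N (m - 1 - j + 1) - rN P σ N m j * qN P σ N (m - 1 - j) =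
          (rN P σ N (m + 1) j - rN P σ N m j) * qN P σ N (m - 1 - j + 1) +
            rN P σ N m j * (qN P σ N (m - 1 - j + 1) - qN P σ N (m - 1 - j)) := by ring
      rw [hsplit]
      calc |(rN P σ N (m + 1) j - rN P σ N m j) * qN P σ N (m - 1 - j + 1) +
            rN P σ N m j * (qN P σ N (m - 1 - j + 1) - qN P σ N (m - 1 - j))|
          ≤ |(rN P σ N (m + 1) j - rN P σ N m j) * qN P σ N (m - 1 - j + 1)| +
            |rN P σ N m j * (qN P σ N (m - 1 - j + 1) - qN P σ N (m - 1 - j))| := abs_add_le _ _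
        _ = |rN P σ N (m + 1) j - rN P σ N m j| * qN P σ N (m - 1 - j + 1) +
            rN P σ N m j * |qN P σ N (m - 1 - j + 1) - qN P σ N (m - 1 - j)| := by
            rw [abs_mul, abs_mul, abs_of_nonneg hq0, abs_of_nonneg hr0]
        _ ≤ (j * 2 ^ j * D) * 2 + 2 ^ j * D := by gcongr
        _ ≤ ((j + 1 : ℕ) : ℝ) * 2 ^ (j + 1) * D := by
            have h2j : (0 : ℝ) ≤ 2 ^ j * D := mul_nonneg (pow_nonneg zero_le_two j) hD
            push_cast
            rw [pow_succ]
            nlinarith [h2j]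

omit hsmall in
/-- **The difference identity** (ratio identity at `m + 1` and at `m`, Pascal's rule):
`1/q_N(m+1) - 1/q_N(m) = Σ_{i ≤ m} C(m,i) W¹(i+2) r_N(m+1,i+1) + Σ_{i<m} C(m,i+1) W¹(i+2) (r_N(m+1,i+1) - r_N(m,i+1))`
for `m + 1 ≤ N`. [folklore] -/
theorem inv_qN_succ_sub_inv_qN {N m : ℕ} (hm : m + 1 ≤ N) :
    (qN P σ N (m + 1))⁻¹ - (qN P σ N m)⁻¹ =
      ∑ i ∈ range (m + 1), (m.choose i : ℝ) * Wd P (hsDiameter σ N) (N + 1) (fun _ => 1) (i + 2) *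
          rN P σ N (m + 1) (i + 1) +
        ∑ i ∈ range m, coefN P σ N (fun _ => 1) m (i + 1) *
          (rN P σ N (m + 1) (i + 1) - rN P σ N m (i + 1)) := by
  have hl1 := h.ovDensity_lt_one
  rw [inv_qN_eq_sum h.σ_pos.le h.σ_lt_half hl1 (m := m + 1) hm, inv_qN_eq_sum h.σ_pos.le h.σ_lt_half hl1 (m := m) (by omega),
    sum_range_succ' (fun j => coefN P σ N (fun _ => 1) (m + 1) j * rN P σ N (m + 1) j),
    sum_range_succ' (fun j => coefN P σ N (fun _ => 1) m j * rN P σ N m j),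
    coefN_one_zero, coefN_one_zero, rN_zero h.σ_pos.le h.σ_lt_half hl1 (by omega : m + 1 ≤ N + 1),
    rN_zero h.σ_pos.le h.σ_lt_half hl1 (by omega : m ≤ N + 1)]
  have hpascal : ∀ i ∈ range (m + 1),
      coefN P σ N (fun _ => 1) (m + 1) (i + 1) * rN P σ N (m + 1) (i + 1) =
        (m.choose i : ℝ) * Wd P (hsDiameter σ N) (N + 1) (fun _ => 1) (i + 2) * rN P σ N (m + 1) (i + 1) +
          coefN P σ N (fun _ => 1) m (i + 1) * rN P σ N (m + 1) (i + 1) := by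
    intro i _
    rw [coefN, coefN, Nat.choose_succ_succ', Nat.cast_add]
    ring
  rw [sum_congr rfl hpascal, sum_add_distrib,
    sum_range_succ (fun i => coefN P σ N (fun _ => 1) m (i + 1) * rN P σ N (m + 1) (i + 1)) m]
  have hzero : coefN P σ N (fun _ => 1) m (m + 1) = 0 := by
    rw [coefN, Nat.choose_succ_self, Nat.cast_zero, zero_mul]
  rw [hzero, zero_mul, add_zero]
  simp only [mul_sub, sum_sub_distrib]
  ring

/-- **The one-step estimate.** If `|q_N(k+1) - q_N(k)| ≤ D` for all `k < m` (`m + 1 ≤ N`), then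
`|1/q_N(m+1) - 1/q_N(m)| ≤ 8e² p_ε + 8e² λ D`. [folklore] -/
theorem abs_inv_qN_succ_sub_inv_qN_le {N m : ℕ} (hm : m + 1 ≤ N) {D : ℝ} (hD : 0 ≤ D)
    (hq : ∀ k < m, |qN P σ N (k + 1) - qN P σ N k| ≤ D) :
    |(qN P σ N (m + 1))⁻¹ - (qN P σ N m)⁻¹| ≤
      8 * Real.exp 1 ^ 2 * pOv P (hsDiameter σ N) + 8 * Real.exp 1 ^ 2 * ovDensity P σ * D := by
  have hl1 := h.ovDensity_lt_one
  have hl0 : 0 ≤ ovDensity P σ := h.ovDensity_nonneg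
  have hθ0 : 0 ≤ geomRatio P σ := h.geomRatio_nonneg
  have hθ : geomRatio P σ ≤ 1 / 2 := geomRatio_le_half_of_ovDensity_le hsmall h.σ_pos.le
  have hε0 : 0 ≤ hsDiameter σ N := hsDiameter_nonneg' h.σ_pos.le N
  have hε2 : hsDiameter σ N < 1 / 2 := hsDiameter_lt_half h.σ_pos.le h.σ_lt_half N
  set p : ℝ := pOv P (hsDiameter σ N) with hpdef
  have hp0 : 0 ≤ p := pOv_nonneg P hε0
  have hmp : (m : ℝ) * p ≤ ovDensity P σ := mul_pOv_le_ovDensity h.σ_pos.le (by omega)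
  have hmp0 : 0 ≤ (m : ℝ) * p := by positivity
  have he0 : 0 ≤ Real.exp 1 := (Real.exp_pos 1).le
  rw [inv_qN_succ_sub_inv_qN h hm]
  refine (abs_add_le _ _).trans (add_le_add ?_ ?_)
  · -- the clusters containing both new labels: `Σ_{i ≤ m} C(m,i) |W¹(i+2)| 2^{i+1} ≤ 8 e² p`
    refine (abs_sum_le_sum_abs _ _).trans ?_
    have hterm : ∀ i ∈ range (m + 1),
        |(m.choose i : ℝ) * Wd P (hsDiameter σ N) (N + 1) (fun _ => 1) (i + 2) * rN P σ N (m + 1) (i + 1)| ≤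
          2 * Real.exp 1 ^ 2 * p * (((i : ℝ) + 1) * geomRatio P σ ^ i) := by
      intro i hi
      have him : i ≤ m := Nat.lt_succ_iff.mp (mem_range.mp hi)
      have hW := abs_Wd_le (P := P) (n := N + 1) hε0 hε2 (g := fun _ => (1 : ℝ)) measurable_const
        (C := 1) (fun _ => by simp) (k := i + 2) (by omega) (by omega)
      rw [one_mul, show i + 2 - 1 = i + 1 from rfl] at hW
      have hchoose : (m.choose i : ℝ) ≤ (m : ℝ) ^ i / i.factorial := Nat.choose_le_pow_div i m
      have hr0 : 0 ≤ rN P σ N (m + 1) (i + 1) :=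
        zero_le_one.trans (one_le_rN h.σ_pos.le h.σ_lt_half hl1 (by omega) (by omega))
      have hr2 : rN P σ N (m + 1) (i + 1) ≤ 2 ^ (i + 1) := h.rN_le_two_pow (by omega) (by omega)
      have htree := treeNumber_succ_succ_mul_pow_div_factorial_le hmp0 i
      rw [abs_mul, abs_mul, Nat.abs_cast, abs_of_nonneg hr0]
      calc (m.choose i : ℝ) * |Wd P (hsDiameter σ N) (N + 1) (fun _ => 1) (i + 2)| * rN P σ N (m + 1) (i + 1)
          ≤ ((m : ℝ) ^ i / i.factorial) * ((treeNumber (i + 2) : ℝ) * p ^ (i + 1)) * 2 ^ (i + 1) := by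
            gcongr
        _ = 2 * p * 2 ^ i * ((treeNumber (i + 2) : ℝ) * ((m : ℝ) * p) ^ i / i.factorial) := by
            rw [mul_pow, pow_succ, pow_succ]; ring
        _ ≤ 2 * p * 2 ^ i * (Real.exp 1 ^ 2 * (i + 1) * (Real.exp 1 * ((m : ℝ) * p)) ^ i) := by
            gcongr
        _ = 2 * Real.exp 1 ^ 2 * p * (((i : ℝ) + 1) * (2 * Real.exp 1 * ((m : ℝ) * p)) ^ i) := by
            rw [mul_pow, mul_pow, mul_pow]; ring
        _ ≤ 2 * Real.exp 1 ^ 2 * p * (((i : ℝ) + 1) * geomRatio P σ ^ i) := by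
            unfold geomRatio
            gcongr
    refine (sum_le_sum hterm).trans ?_
    rw [← mul_sum]
    calc 2 * Real.exp 1 ^ 2 * p * ∑ i ∈ range (m + 1), ((i : ℝ) + 1) * geomRatio P σ ^ i
        ≤ 2 * Real.exp 1 ^ 2 * p * 4 :=
          mul_le_mul_of_nonneg_left (sum_succ_mul_pow_le_four hθ0 hθ (m + 1)) (by positivity)
      _ = 8 * Real.exp 1 ^ 2 * p := by ring
  · -- the difference of the ratio products: `Σ_{i<m} e (eλ)^{i+1} (i+1) 2^{i+1} D ≤ 8 e² λ D`
    refine (abs_sum_le_sum_abs _ _).trans ?_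
    have hterm : ∀ i ∈ range m,
        |coefN P σ N (fun _ => 1) m (i + 1) * (rN P σ N (m + 1) (i + 1) - rN P σ N m (i + 1))| ≤
          Real.exp 1 * geomRatio P σ * D * (((i : ℝ) + 1) * geomRatio P σ ^ i) := by
      intro i hi
      have him : i < m := mem_range.mp hi
      have hc := abs_coefN_le (P := P) h.σ_pos.le h.σ_lt_half (g := fun _ => (1 : ℝ)) measurable_const (C := 1)
        (fun _ => by simp) (N := N) (m := m) (j := i + 1) (by omega) (by omega)
      rw [one_mul] at hc
      have hr := abs_rN_succ_sub_rN_le h (N := N) (m := m) (by omega) hD hq (j := i + 1) (by omega)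
      rw [abs_mul]
      calc |coefN P σ N (fun _ => 1) m (i + 1)| * |rN P σ N (m + 1) (i + 1) - rN P σ N m (i + 1)|
          ≤ (Real.exp 1 * (Real.exp 1 * ovDensity P σ) ^ (i + 1)) * (((i + 1 : ℕ) : ℝ) * 2 ^ (i + 1) * D) :=
            mul_le_mul hc hr (abs_nonneg _) (by positivity)
        _ = Real.exp 1 * geomRatio P σ * D * (((i : ℝ) + 1) * geomRatio P σ ^ i) := by
            unfold geomRatio
            push_cast
            rw [mul_pow, mul_pow, mul_pow, pow_succ, pow_succ, pow_succ]; ring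
    refine (sum_le_sum hterm).trans ?_
    rw [← mul_sum]
    calc Real.exp 1 * geomRatio P σ * D * ∑ i ∈ range m, ((i : ℝ) + 1) * geomRatio P σ ^ i
        ≤ Real.exp 1 * geomRatio P σ * D * 4 :=
          mul_le_mul_of_nonneg_left (sum_succ_mul_pow_le_four hθ0 hθ m) (by positivity)
      _ = 8 * Real.exp 1 ^ 2 * ovDensity P σ * D := by unfold geomRatio; ring

/-- **The induction**: `|q_N(m+1) - q_N(m)| ≤ 64 e² p_ε` for all `m + 1 ≤ N`. [folklore] -/
theorem abs_qN_succ_sub_qN_le_pOv {N : ℕ} :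
    ∀ m : ℕ, m + 1 ≤ N → |qN P σ N (m + 1) - qN P σ N m| ≤ 64 * Real.exp 1 ^ 2 * pOv P (hsDiameter σ N) := by
  have hl1 := h.ovDensity_lt_one
  have hl0 : 0 ≤ ovDensity P σ := h.ovDensity_nonneg
  have hε0 : 0 ≤ hsDiameter σ N := hsDiameter_nonneg' h.σ_pos.le N
  set p : ℝ := pOv P (hsDiameter σ N) with hpdef
  have hp0 : 0 ≤ p := pOv_nonneg P hε0
  have he0 : 0 ≤ Real.exp 1 := (Real.exp_pos 1).le
  have hD0 : 0 ≤ 64 * Real.exp 1 ^ 2 * p := by positivity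
  -- `32 e² λ ≤ 1/2`
  have hcontr : 32 * Real.exp 1 ^ 2 * ovDensity P σ ≤ 1 / 2 := by
    have h1 : 32 * Real.exp 1 ^ 2 * ovDensity P σ ≤ 32 * Real.exp 1 ^ 2 * (1 / (64 * Real.exp 1 ^ 2)) :=
      mul_le_mul_of_nonneg_left hsmall (by positivity)
    refine h1.trans (le_of_eq ?_)
    have : Real.exp 1 ^ 2 ≠ 0 := by positivity
    field_simp
    ring
  -- strong induction on `m`
  suffices H : ∀ n m : ℕ, m < n → m + 1 ≤ N → |qN P σ N (m + 1) - qN P σ N m| ≤ 64 * Real.exp 1 ^ 2 * p from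
    fun m hm => H (m + 1) m (Nat.lt_succ_self m) hm
  intro n
  induction n with
  | zero => intro m hm; exact absurd hm (Nat.not_lt_zero m)
  | succ n ih =>
      intro m hmn hmN
      rcases Nat.lt_succ_iff_lt_or_eq.mp hmn with hlt | rfl
      · exact ih m hlt hmN
      · -- the step at `m`: all earlier differences are `≤ D = 64 e² p`
        have hq : ∀ k < m, |qN P σ N (k + 1) - qN P σ N k| ≤ 64 * Real.exp 1 ^ 2 * p :=
          fun k hk => ih k hk (by omega)
        have hstep := abs_inv_qN_succ_sub_inv_qN_le h hsmall hmN hD0 hq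
        have hq1 : 0 < qN P σ N m := qN_pos h.σ_pos.le h.σ_lt_half hl1 (by omega)
        have hq2 : 0 < qN P σ N (m + 1) := qN_pos h.σ_pos.le h.σ_lt_half hl1 (by omega)
        have hq1' : qN P σ N m ≤ 2 := h.qN_le_two (by omega)
        have hq2' : qN P σ N (m + 1) ≤ 2 := h.qN_le_two (by omega)
        have hid : qN P σ N (m + 1) - qN P σ N m =
            qN P σ N (m + 1) * qN P σ N m * ((qN P σ N m)⁻¹ - (qN P σ N (m + 1))⁻¹) := by
          field_simp
        rw [hid, abs_mul, abs_mul, abs_of_pos hq1, abs_of_pos hq2, abs_sub_comm]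
        calc qN P σ N (m + 1) * qN P σ N m * |(qN P σ N (m + 1))⁻¹ - (qN P σ N m)⁻¹|
            ≤ 2 * 2 * (8 * Real.exp 1 ^ 2 * p + 8 * Real.exp 1 ^ 2 * ovDensity P σ * (64 * Real.exp 1 ^ 2 * p)) := by
              gcongr
          _ = 32 * Real.exp 1 ^ 2 * p + (32 * Real.exp 1 ^ 2 * ovDensity P σ) * (64 * Real.exp 1 ^ 2 * p) := by
              ring
          _ ≤ 32 * Real.exp 1 ^ 2 * p + (1 / 2) * (64 * Real.exp 1 ^ 2 * p) := by gcongr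
          _ = 64 * Real.exp 1 ^ 2 * p := by ring

end Bounds

/-- **LIPSCHITZ BOUND FOR THE INSERTION RATIOS OF THE CANONICAL HARD-SPHERE GAS ON `𝕋³` AT LOW DENSITY**
(approximate log-concavity of the canonical configurational partition functions in the particle number).
Along the scaling `ε_N = σ (N+1)^{-1/3}` of `HardSphereEulerRatio`, with `Ξ_N(m)` the hard-core probability of
`m` independent `β`-distributed points of `𝕋³` at minimal-image distance `≥ ε_N` and
`q_N(m) = Ξ_N(m)/Ξ_N(m+1)` the inverse insertion probabilities: if `0 < σ < 1/2` and
`λ = M v₁ σ³ ≤ 1/(64e²)` (on top of the smallness conditions `SmallDensity P σ` of the tree's statics), then `|q_N(m+1) - q_N(m)| ≤ 64 e² λ/(N+1)` for all `m + 1 ≤ N`.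
[cite: PulvirentiTsagkarogiannis2012, Thm 2.1] -/
theorem hs_insertionRatio_lipschitz :
    ∀ (P : DensityProfile) (σ : ℝ), SmallDensity P σ →
      ovDensity P σ ≤ 1 / (64 * Real.exp 1 ^ 2) →
      ∀ (N m : ℕ), m + 1 ≤ N →
        |qN P σ N (m + 1) - qN P σ N m| ≤ 64 * Real.exp 1 ^ 2 * ovDensity P σ / ((N + 1 : ℕ) : ℝ) := by
  intro P σ h hsmall N m hm
  have h' := abs_qN_succ_sub_qN_le_pOv h hsmall m hm
  rwa [pOv_hsDiameter, ← mul_div_assoc] at h'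

end

end Summit.AtomisticToContinuum.HydrodynamicLimit.Theorems.LightConeInLawSVC.CountLCLT
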